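import Summits.AtomisticToContinuum.FouriersLaw.Theses.ProfileLadder

/-!
# Birth skeleton (BC3) for the crux `ProfileLadder.LocalFourierLaw`
(crux item stmt-AtomisticToContinuum-12675, rank 2 of route `route-AtomisticToContinuum-ProfileLadder`,
sub-problem `FouriersLaw`; registrar `planner-skel-stmt-AtomisticToContinuum-12675-0`, 2026-08-17;
published as `Cruxes/LocalFourierLaw/Lines/birth.lean`)

Crux (FIXED, concluded BY NAME below): `Summit.AtomisticToContinuum.FouriersLaw.Theses.ProfileLadder.LocalFourierLaw`
— for `pinnedChain ω₂ lam β γ` (all `> 0`), under weak-NESS uniqueness, for every `T > 0` there is ONE `κ > 0`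
(quantified BEFORE the steady-state family) such that for every family `μ` and every `ε > 0` there are a
contact depth `b` and `N₀` with: for all `N ≥ N₀`, every current response `d = D_N` and every kinetic
response profile `θ = θ_N` (the two `Tendsto` clauses along `𝓝[≠] 0`), at every bulk bond `(i, i+1)` with
`b ≤ i`, `i + 1 + b + 1 ≤ N`: `|θ(i+1) − θ(i) + d/((N−1)κ)| ≤ ε(|d|+1)/(N−1)` (Fourier's law bond by bond,
one `κ` for all `N`).

## Line `birth` — LOCAL EQUIDISTRIBUTION × GLOBAL ONE-κ SECANT LAW (the bulk rung cut along its two contents)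

The crux asserts two logically independent things about the bulk window `[b, N−1−b]` of the response
profile: (1) the profile is AFFINE there (all bulk increments agree to relative precision `ε` — linearised
local thermal equilibrium with a constant current forces a constant gradient; no meniscus, no `k = π`
staggering), and (2) the SLOPE is `−(per-bond current response)/κ` with ONE material constant `κ(T)` for all
`N` (existence of the conductivity as an `N`-independent bulk constant: the bulk segment's resistance is its
length over `κ`, whatever the contacts do). The skeleton types exactly these two halves over the crux's own
vocabulary (nothing but `PhaseSpace`, `pinnedChain`, `IsSteadyState`, `totalCurrent`, the two limit clauses),
reading the slope of (2) as the SECANT slope `(θ(N−1−b) − θ(b))/(N−1−2b)` of the bulk window, so that no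
implicitly defined object (`κ_N`, "the" slope) enters a signature:

* `stub_bulkAffine` (LOCAL EQUIDISTRIBUTION; no `κ` at all; size L–XL, open for `lam, β > 0`): for every
  `T > 0`, family, `ε > 0` there is `b₀` such that for every depth `b ≥ b₀` there is `N₀` with: for all
  `N ≥ N₀`, all response data `(d, θ)` and the window endpoints `p = b`, `q = N−1−b`, every bulk increment
  satisfies `|θ(i+1) − θ(i) − (θ q − θ p)/(N−1−2b)| ≤ ε(|d|+1)/(N−1)`. It HOLDS at the harmonic corner
  `lam = β = 0` (flat Rieder–Lebowitz–Lieb bulk: increments and secant both exponentially small while the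
  allowance `ε(|d|+1)/(N−1) ≍ ε` is huge since `d ≍ N`), where the crux is FALSE — so it cannot imply the
  crux; for the anharmonic chain (`d = O(1)` expected) the allowance `≍ ε/N` is of the order of the
  increments themselves, i.e. the statement is the sharp "affine bulk to relative precision ε".
* `stub_bulkOhm` (GLOBAL ONE-κ SECANT LAW; size XL / open-problem strength — the HARDEST stub, it carries
  the `N`-independence of the bulk resistivity): for every `T > 0` there is `κ > 0` (before the family) such
  that for every family, `ε > 0` there is `b₀` with: for every `b ≥ b₀` there is `N₀` such that for all
  `N ≥ N₀` and all response data, `|(θ q − θ p)/(N−1−2b) + d/((N−1)κ)| ≤ ε(|d|+1)/(N−1)` — the temperature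
  drop across the bulk window divided by (number of bulk bonds × per-bond current response) tends to `1/κ`.
  FALSE at the harmonic corner (flat bulk, `d ≍ N`). It does NOT give the crux alone (a staggered or
  meniscus-shaped bulk with the right secant satisfies it) and it does NOT give `FouriersLaw` alone (the
  route still needs `KapitzaBound`, `ProfileTelescoping` and the finite-response supports to pass from the
  bulk secant to `D_N → κ`); conversely the crux implies both stubs (average the bond law over the window),
  so neither stub is a stronger bet than the crux itself.
* COMPOSITION `LocalFourierLaw_of : LocalFourierLaw` — kernel-checked, no `sorry` of its own: `κ` from
  `stub_bulkOhm`; given the family and `ε`, run both stubs at `ε/2`, take `b = max b_A b_B`,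
  `N₀ = max N_A N_B`; a bulk bond `(i, i+1)` with `b ≤ i`, `i+1+b+1 ≤ N` forces `N ≥ 2b+2`, so the endpoints
  `p = ⟨b, _⟩`, `q = ⟨N−1−b, _⟩ : Fin N` exist; then
  `|θ j − θ i + d/((N−1)κ)| ≤ |θ j − θ i − m| + |m + d/((N−1)κ)| ≤ (ε/2 + ε/2)(|d|+1)/(N−1)` with `m` the
  secant slope. (The stubs are invoked BY NAME inside the proof rather than taken as binders because the
  skeleton audit `#h21_check_skeleton` admits only named obligations as hypotheses; logically this is
  `stub_bulkAffine → stub_bulkOhm → LocalFourierLaw`, and `localFourierLaw_of_affine_of_ohm` below is that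
  implication with the two signatures as explicit hypotheses, concluding the UNFOLDED crux so that exactly one
  theorem of this file concludes `LocalFourierLaw` by name.)

Where the route's engines plug in (not stubs here; layer below, `--supports LocalFourierLaw`): the route header's
TWO-LAYER PLAN `BulkAffine → ResistivityLocality` feeds `stub_bulkOhm` (per-`N` secant resistivity
`ρ_N(b) := −(N−1)·secant/d`, then `ρ_N` Cauchy in `N` by spatial locality of the linear response — "the bulk
forgets where the far bath is"), and the McLennan representation (`θ_N(x) = ½(1−2x/(N−1)) + transfer term`,
Mclennan1959 / MaesNetocny2010 / ReyBellet2003 Rem. 4.4) is the common tool for both stubs.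

Disproof used: none — `ledger crux ls stmt-AtomisticToContinuum-12675` showed no workfiles (no `Disproof.lean`,
no `Negative/` lemma, no dead line) at registration, 2026-08-17. Refuter evidence honoured (CruxAttack.lean,
rattack-12675, SURVIVES): both stubs keep the crux's full parameter / uniqueness / family / limit prefix
verbatim (so neither is a statement about arbitrary `θ`), and the harmonic-corner falsity of the crux sits in
`stub_bulkOhm` (consistent with `Literature.Barriers.AtomisticToContinuum.HarmonicChainBallisticFlux`).
Negatives index (`ledger negatives --problem AtomisticToContinuum`): no profile-type entry; nothing re-asked.

BC3 probes (planner folder `bc/probes/`, quoted in NOTES.md `birth-certificate:` and `Lines/birth.md`): for each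
stub `S`, `S → LocalFourierLaw` and `S → FouriersLaw` by `first | exact? | simpa | aesop` FAIL.
-/

set_option autoImplicit false

namespace Summit.AtomisticToContinuum.FouriersLaw.Cruxes.LocalFourierLaw.Birth

open MeasureTheory Filter Topology
open Literature.MathematicalPhysics.KineticTheory.HeatConduction
open Summit.AtomisticToContinuum.FouriersLaw.Theses.ProfileLadder (LocalFourierLaw)

set_option linter.unusedVariables false

/-! ## Stub 1 — local equidistribution of the bulk increments (affine bulk profile) -/

/-- **`stub_bulkAffine`** (LOCAL EQUIDISTRIBUTION / AFFINE BULK; size L–XL). For `pinnedChain ω₂ lam β γ`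
(all `> 0`), under weak-NESS uniqueness, for every `T > 0`, every steady-state family `μ` and every `ε > 0`
there is a depth `b₀` such that for every `b ≥ b₀` there is `N₀` with: for all `N ≥ N₀`, every current
response `d` and kinetic response profile `θ` (limit clauses as in the crux), the window endpoints `p = b`,
`q = N − 1 − b` and every bulk bond `(i, i+1)` with `b ≤ i`, `i + 1 + b + 1 ≤ N`:
`|θ j − θ i − (θ q − θ p)/(N − 1 − 2b)| ≤ ε (|d| + 1)/(N − 1)` — every bulk increment equals the secant
slope of the bulk window to relative precision `ε`. No conductivity appears. Why plausibly true: linearised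
local thermal equilibrium in the bulk with a bond-independent current (stationarity) forces a constant
kinetic-temperature gradient away from the contact layers (BonettoLebowitzReyBellet2000 §6–7;
LepriLiviPoliti2016 §1.3.5: linear bulk profiles for normal transport); it holds at the harmonic corner
(flat bulk), so it cannot imply the crux. Why it might fail: a bulk "meniscus" (non-affine profile at fixed
relative depth, as in anomalous chains), persistent `k = π` staggering of `θ`, or window dependence of the
local slope — kill criterion (a) of the route. Leans on: `FiniteResponseProfile` / `FiniteResponseOfUnique`
(closed supports, to instantiate `d, θ`), `NessUnique_holds`, McLennan representation (support to be attached).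
Sources: BonettoLebowitzReyBellet2000, LepriLiviPoliti2016, AokiKusnezov2001, MaesNetocny2010. -/
theorem stub_bulkAffine :
    ∀ ω₂ lam β γ : ℝ, 0 < ω₂ → 0 < lam → 0 < β → 0 < γ →
    (∀ (N : ℕ) (T_L T_R : ℝ), 0 < T_L → 0 < T_R → ∀ μ ν : Measure (PhaseSpace N),
      (pinnedChain ω₂ lam β γ).IsSteadyState N T_L T_R μ →
      (pinnedChain ω₂ lam β γ).IsSteadyState N T_L T_R ν → μ = ν) →
    ∀ T : ℝ, 0 < T →
    ∀ μ : (N : ℕ) → ℝ → ℝ → Measure (PhaseSpace N),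
    (∀ (N : ℕ) (T_L T_R : ℝ), 0 < T_L → 0 < T_R →
      (pinnedChain ω₂ lam β γ).IsSteadyState N T_L T_R (μ N T_L T_R)) →
    ∀ ε : ℝ, 0 < ε → ∃ b₀ : ℕ, ∀ b : ℕ, b₀ ≤ b → ∃ N₀ : ℕ, ∀ (N : ℕ) (d : ℝ) (θ : Fin N → ℝ), N₀ ≤ N →
      Tendsto (fun δ : ℝ => (pinnedChain ω₂ lam β γ).totalCurrent (μ N (T + δ / 2) (T - δ / 2)) / δ)
        (nhdsWithin 0 {(0 : ℝ)}ᶜ) (nhds d) →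
      (∀ i : Fin N, Tendsto (fun δ : ℝ => ((∫ x, (x.2 i) ^ 2 ∂(μ N (T + δ / 2) (T - δ / 2))) -
        ∫ x, (x.2 i) ^ 2 ∂(μ N T T)) / δ) (nhdsWithin 0 {(0 : ℝ)}ᶜ) (nhds (θ i))) →
      ∀ p q : Fin N, p.val = b → q.val + b + 1 = N →
      ∀ i j : Fin N, j.val = i.val + 1 → b ≤ i.val → j.val + b + 1 ≤ N →
        |θ j - θ i - (θ q - θ p) / ((N : ℝ) - 1 - 2 * (b : ℝ))| ≤ ε * ((|d| + 1) / ((N : ℝ) - 1)) := by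
  sorry

/-! ## Stub 2 — the one-κ secant law for the bulk window (bulk resistance = length / κ) -/

/-- **`stub_bulkOhm`** (GLOBAL ONE-κ SECANT LAW FOR THE BULK; size XL / open-problem strength; the HARDEST
stub). For `pinnedChain ω₂ lam β γ` (all `> 0`), under weak-NESS uniqueness, for every `T > 0` there is
`κ > 0` — quantified BEFORE the family, as in the crux — such that for every steady-state family `μ` and every
`ε > 0` there is `b₀` with: for every `b ≥ b₀` there is `N₀` such that for all `N ≥ N₀`, every current
response `d`, kinetic response profile `θ` (limit clauses as in the crux) and the window endpoints `p = b`,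
`q = N − 1 − b`: `|(θ q − θ p)/(N − 1 − 2b) + d/((N − 1) κ)| ≤ ε (|d| + 1)/(N − 1)` — the secant slope of the
bulk window is minus the per-bond current response over `κ`; equivalently the resistance of the bulk segment
(temperature-response drop across it divided by the per-bond current response) is its length over ONE `κ(T)`,
whatever the contact layers do. Why plausibly true: it is the bulk half of the BLR conjecture read off the
McLennan profile `θ_N(x) = ½(1 − 2x/(N−1)) + (1/((N−1)T²))∫₀^∞⟨J_tot(0); p_x²(t)⟩dt` (Mclennan1959,
MaesNetocny2010, KunduDharNarayan2009), whose bulk secant resistivity should stabilise in `N` by spatial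
locality of the linear response (route header, TWO-LAYER PLAN: `ResistivityLocality`); numerically
`κ(N) = κ/(1 + aℓ/N)` fits (AokiKusnezov2001). Why it might fail: the secant resistivity may drift in `N`
(`κ_N → 0` or `∞`, or oscillate) — no engine for a deterministic bulk is in print (Bernardin2014 §2: the
fluctuation–dissipation decomposition is open); FALSE at `lam = β = 0` (flat bulk with `d ≍ N`,
RiederLebowitzLieb1967), so a proof must use `lam, β > 0`. Leans on: `FiniteResponseOfUnique`,
`FiniteResponseProfile`, `NessUnique_holds`; `Literature.Barriers.AtomisticToContinuum.HarmonicChainBallisticFlux`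
(calibration). Sources: BonettoLebowitzReyBellet2000, Bernardin2014, AokiKusnezov2001, RiederLebowitzLieb1967,
Dhar2008. -/
theorem stub_bulkOhm :
    ∀ ω₂ lam β γ : ℝ, 0 < ω₂ → 0 < lam → 0 < β → 0 < γ →
    (∀ (N : ℕ) (T_L T_R : ℝ), 0 < T_L → 0 < T_R → ∀ μ ν : Measure (PhaseSpace N),
      (pinnedChain ω₂ lam β γ).IsSteadyState N T_L T_R μ →
      (pinnedChain ω₂ lam β γ).IsSteadyState N T_L T_R ν → μ = ν) →
    ∀ T : ℝ, 0 < T → ∃ κ : ℝ, 0 < κ ∧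
    ∀ μ : (N : ℕ) → ℝ → ℝ → Measure (PhaseSpace N),
    (∀ (N : ℕ) (T_L T_R : ℝ), 0 < T_L → 0 < T_R →
      (pinnedChain ω₂ lam β γ).IsSteadyState N T_L T_R (μ N T_L T_R)) →
    ∀ ε : ℝ, 0 < ε → ∃ b₀ : ℕ, ∀ b : ℕ, b₀ ≤ b → ∃ N₀ : ℕ, ∀ (N : ℕ) (d : ℝ) (θ : Fin N → ℝ), N₀ ≤ N →
      Tendsto (fun δ : ℝ => (pinnedChain ω₂ lam β γ).totalCurrent (μ N (T + δ / 2) (T - δ / 2)) / δ)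
        (nhdsWithin 0 {(0 : ℝ)}ᶜ) (nhds d) →
      (∀ i : Fin N, Tendsto (fun δ : ℝ => ((∫ x, (x.2 i) ^ 2 ∂(μ N (T + δ / 2) (T - δ / 2))) -
        ∫ x, (x.2 i) ^ 2 ∂(μ N T T)) / δ) (nhdsWithin 0 {(0 : ℝ)}ᶜ) (nhds (θ i))) →
      ∀ p q : Fin N, p.val = b → q.val + b + 1 = N →
        |(θ q - θ p) / ((N : ℝ) - 1 - 2 * (b : ℝ)) + d / (((N : ℝ) - 1) * κ)| ≤
          ε * ((|d| + 1) / ((N : ℝ) - 1)) := by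
  sorry

/-! ## The seam (proved): triangle inequality through the secant slope -/

/-- The real-number seam of the composition: if an increment `x` is within `ε/2 · y` of the secant `m` and
`m + c` is within `ε/2 · y` of `0`, then `x + c` is within `ε · y` of `0`. [folklore] -/
theorem abs_add_le_of_near_secant {x m c ε y : ℝ} (hx : |x - m| ≤ ε / 2 * y) (hm : |m + c| ≤ ε / 2 * y) :
    |x + c| ≤ ε * y := by
  have e : x + c = (x - m) + (m + c) := by ring
  calc |x + c| = |(x - m) + (m + c)| := by rw [← e]
    _ ≤ |x - m| + |m + c| := abs_add_le _ _
    _ ≤ ε / 2 * y + ε / 2 * y := add_le_add hx hm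
    _ = ε * y := by ring

/-! ## The composition: `LocalFourierLaw` from the two stubs -/

/-- **`localFourierLaw_of_affine_of_ohm`** — the implication "stub signatures → crux", sorry-free, with the two
stub statements as explicit hypotheses (`type_of%` = literally their signatures) and the crux UNFOLDED as the
conclusion (so that `LocalFourierLaw_of` below is the only theorem of this file concluding the crux by name).
Proof: `κ` from the secant law; both stubs at `ε/2`; `b = max b_A b_B`, `N₀ = max N_A N_B`; endpoints
`⟨b, _⟩, ⟨N − 1 − b, _⟩ : Fin N` exist because a bulk bond forces `N ≥ 2b + 2`; triangle inequality. -/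
theorem localFourierLaw_of_affine_of_ohm (hA : type_of% stub_bulkAffine) (hB : type_of% stub_bulkOhm) :
    ∀ ω₂ lam β γ : ℝ, 0 < ω₂ → 0 < lam → 0 < β → 0 < γ →
    (∀ (N : ℕ) (T_L T_R : ℝ), 0 < T_L → 0 < T_R → ∀ μ ν : Measure (PhaseSpace N),
      (pinnedChain ω₂ lam β γ).IsSteadyState N T_L T_R μ →
      (pinnedChain ω₂ lam β γ).IsSteadyState N T_L T_R ν → μ = ν) →
    ∀ T : ℝ, 0 < T → ∃ κ : ℝ, 0 < κ ∧
    ∀ μ : (N : ℕ) → ℝ → ℝ → Measure (PhaseSpace N),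
    (∀ (N : ℕ) (T_L T_R : ℝ), 0 < T_L → 0 < T_R →
      (pinnedChain ω₂ lam β γ).IsSteadyState N T_L T_R (μ N T_L T_R)) →
    ∀ ε : ℝ, 0 < ε → ∃ b N₀ : ℕ, ∀ (N : ℕ) (d : ℝ) (θ : Fin N → ℝ), N₀ ≤ N →
      Tendsto (fun δ : ℝ => (pinnedChain ω₂ lam β γ).totalCurrent (μ N (T + δ / 2) (T - δ / 2)) / δ)
        (nhdsWithin 0 {(0 : ℝ)}ᶜ) (nhds d) →
      (∀ i : Fin N, Tendsto (fun δ : ℝ => ((∫ x, (x.2 i) ^ 2 ∂(μ N (T + δ / 2) (T - δ / 2))) -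
        ∫ x, (x.2 i) ^ 2 ∂(μ N T T)) / δ) (nhdsWithin 0 {(0 : ℝ)}ᶜ) (nhds (θ i))) →
      ∀ i j : Fin N, j.val = i.val + 1 → b ≤ i.val → j.val + b + 1 ≤ N →
        |θ j - θ i + d / (((N : ℝ) - 1) * κ)| ≤ ε * ((|d| + 1) / ((N : ℝ) - 1)) := by
  intro ω₂ lam β γ hω hl hβ hγ huniq T hT
  obtain ⟨κ, hκ, hBκ⟩ := hB ω₂ lam β γ hω hl hβ hγ huniq T hT
  refine ⟨κ, hκ, fun μ hμ ε hε => ?_⟩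
  have hε2 : 0 < ε / 2 := half_pos hε
  obtain ⟨bA, hbA⟩ := hA ω₂ lam β γ hω hl hβ hγ huniq T hT μ hμ (ε / 2) hε2
  obtain ⟨bB, hbB⟩ := hBκ μ hμ (ε / 2) hε2
  -- common depth `b ≥ b_A, b_B` and common threshold `N₀ ≥ N_A, N_B`
  obtain ⟨b, hbA', hbB'⟩ : ∃ b : ℕ, bA ≤ b ∧ bB ≤ b := ⟨max bA bB, le_max_left _ _, le_max_right _ _⟩
  obtain ⟨NA, hNA⟩ := hbA b hbA'
  obtain ⟨NB, hNB⟩ := hbB b hbB'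
  obtain ⟨N₀, hN₀A, hN₀B⟩ : ∃ N₀ : ℕ, NA ≤ N₀ ∧ NB ≤ N₀ := ⟨max NA NB, le_max_left _ _, le_max_right _ _⟩
  refine ⟨b, N₀, fun N d θ hN hd hθ i j hij hbi hjb => ?_⟩
  -- a bulk bond forces `N ≥ 2b + 2`, so the window endpoints `b`, `N - 1 - b` are sites
  have hiN : i.val < N := i.isLt
  have hpN : b < N := lt_of_le_of_lt hbi hiN
  have hqN : N - 1 - b < N := by omega
  have hq : (N - 1 - b) + b + 1 = N := by omega
  have h1 := hNA N d θ (le_trans hN₀A hN) hd hθ ⟨b, hpN⟩ ⟨N - 1 - b, hqN⟩ rfl hq i j hij hbi hjb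
  have h2 := hNB N d θ (le_trans hN₀B hN) hd hθ ⟨b, hpN⟩ ⟨N - 1 - b, hqN⟩ rfl hq
  exact abs_add_le_of_near_secant h1 h2

/-- **`LocalFourierLaw_of`** — the crux `ProfileLadder.LocalFourierLaw` BY NAME from the two registered
(sorried) stubs `stub_bulkAffine`, `stub_bulkOhm`; the only place the stubs are consumed, and the only theorem
of this file whose conclusion is the crux declaration. Its own proof term is sorry-free (the `sorry`s it
depends on are exactly those of the two stubs). -/
theorem LocalFourierLaw_of : LocalFourierLaw :=
  localFourierLaw_of_affine_of_ohm stub_bulkAffine stub_bulkOhm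

end Summit.AtomisticToContinuum.FouriersLaw.Cruxes.LocalFourierLaw.Birth
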